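import Summits.Ventures.HSemireg.Mod4SiteSigns
import Summits.Ventures.HSemireg.WedgeWeilDegRank

/-!
# Venture HSemireg — MOD-4 line: the h-part of th-7's Weil model as a two-block word sum, and the rows `μ_B ∧ f`,
# `μ′_{B′} ∧ f` of THEOREM R_f's middle-degree block IN THE MODEL (every `n`, every `q`)

HONEST FRAMING. Part of the Lean index of the computation cell `pub-hsemireg` (widening group W3, seat w3-mod4-1 gen 5; files
of record `HOME/widen/W3/MOD4-OFFSPLIT-w3mod4.md` §10.2 / §11, `MOD4-THEOREM-RF-PROOF-w3mod4.md` v1.0 §4).  Finite-dimensional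
exterior algebra over a field ONLY (th-7's sign-free transposed wedge model, tree files `Wedge*.lean`): no abelian variety, no sheaf,
no Ext group, no semiregularity map; nothing here says that HC, HC_CM or HC_AV holds; no Literature fact is declared or used;
THEOREM R_f is NOT asserted here.  WHAT IS PROVED (type `(n,n)`: `N = n + n` pairs, generators `x_c = e_c`, `y_c = e_{N+c}`;
block `P` = pairs `castAdd n k`, block `Q` = pairs `natAdd n k`, `k < n`; letters `x_k = b(xJ (castAdd n k))`, `y_k = b(yJ (castAdd n k))`,
`x′_k, y′_k` likewise with `natAdd`; words `μ_B = ∏^{<}_k ι(y_k if k ∈ B else x_k)`, `μ′_{B′}` on block `Q`, `m_P = ∏_k ι x_k ι y_k`, `m_Q`):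
* `w_eq_sum_blocks` — th-7's h-part is the two-block word sum **`w_{2n}(q) = Σ_{B₁ ⊆ [n]} Σ_{B₂ ⊆ [n]} q_{|B₁|+|B₂|} · μ_{B₁}·μ′_{B₂}`**
  (from th-7's `Wedge.Weil.f_eq_sum_ιMulti`, regrouping the transversal sets `T ⊆ [2n]` by their two halves);
* `wordP_mul_w` — **`μ_B · w_{2n}(q) = (−1)^{C(n,2)+|B|} · Σ_{B′} q_{n−|B|+|B′|} · (m_P · μ′_{B′})`** (SIGN LEMMA: only `B₁ = Bᶜ` survives);
* `wordQ_mul_w` — **`μ′_{B′} · w_{2n}(q) = (−1)^{n+C(n,2)+|B′|} · Σ_{B} q_{n−|B′|+|B|} · (μ_B · m_Q)`** (commute `μ′` past `μ_{B₁}`: `(−1)^{n·n} = (−1)ⁿ`).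
These are the rows `Σ₁[B,·]`, `Σ₂[B′,·]` of the proof sheet §4 in the tag basis `f_{B′} = m_P μ′_{B′}`, `g_B = μ_B m_Q`, now for th-7's
own `w`; with `q̃_i := (−1)^i q_i` they are exactly the rows of `Mod4SiteUBlock.finrank_span_Ublock` (κ(−1)^{|B′|}q̃_{n−|B|+|B′|} and
(−1)ⁿκ(−1)^{|B|}q̃_{n−|B′|+|B|}, κ = (−1)^{C(n+1,2)}).  No definitions are introduced.
All statements and proofs: w3-mod4-1 g5 (2026-08-23).  Namespace `Summit.Ventures.HSemireg.Mod4Site`.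
-/

namespace Summit.Ventures.HSemireg.Mod4Site

open ExteriorAlgebra Summit.Ventures.HSemireg.Wedge Summit.Ventures.HSemireg.Wedge.Hankel Summit.Ventures.HSemireg.Wedge.Weil

variable {K : Type*} [Field K] {n : ℕ}

/-! ### §1 The transversal sets of `[2n]` by halves -/

/-- membership of a `P`-pair in the set assembled from two halves. -/
lemma castAdd_mem_blocks (s t : Finset (Fin n)) (k : Fin n) :
    Fin.castAdd n k ∈ (s.disjSum t).map finSumFinEquiv.toEmbedding ↔ k ∈ s := by
  rw [Finset.mem_map_equiv, finSumFinEquiv_symm_apply_castAdd, Finset.inl_mem_disjSum]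

/-- membership of a `Q`-pair in the set assembled from two halves. -/
lemma natAdd_mem_blocks (s t : Finset (Fin n)) (k : Fin n) :
    Fin.natAdd n k ∈ (s.disjSum t).map finSumFinEquiv.toEmbedding ↔ k ∈ t := by
  rw [Finset.mem_map_equiv, finSumFinEquiv_symm_apply_natAdd, Finset.inr_mem_disjSum]

/-- th-7's transversal word of `T` splits as the `P`-word times the `Q`-word. -/
lemma ιMulti_vT_blocks (s t : Finset (Fin n)) :
    ExteriorAlgebra.ιMulti K (n + n) (vT K ((s.disjSum t).map finSumFinEquiv.toEmbedding)) =
      (List.ofFn fun k : Fin n => ι K (if k ∈ s then b K (In (n + n)) (yJ (n + n) (Fin.castAdd n k))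
          else b K (In (n + n)) (xJ (n + n) (Fin.castAdd n k)))).prod *
      (List.ofFn fun k : Fin n => ι K (if k ∈ t then b K (In (n + n)) (yJ (n + n) (Fin.natAdd n k))
          else b K (In (n + n)) (xJ (n + n) (Fin.natAdd n k)))).prod := by
  rw [ExteriorAlgebra.ιMulti_apply, List.ofFn_add, List.prod_append]
  congr 1
  · show (List.ofFn fun k : Fin n =>
        ι K (vT K ((s.disjSum t).map finSumFinEquiv.toEmbedding) (Fin.castAdd n k))).prod = _
    refine congrArg _ (congrArg _ (funext fun k => ?_))
    unfold vT
    by_cases hk : k ∈ s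
    · rw [if_pos ((castAdd_mem_blocks s t k).mpr hk), if_pos hk]
    · rw [if_neg (fun h => hk ((castAdd_mem_blocks s t k).mp h)), if_neg hk]
  · refine congrArg _ (congrArg _ (funext fun k => ?_))
    unfold vT
    by_cases hk : k ∈ t
    · rw [if_pos ((natAdd_mem_blocks s t k).mpr hk), if_pos hk]
    · rw [if_neg (fun h => hk ((natAdd_mem_blocks s t k).mp h)), if_neg hk]

/-- **the h-part as a two-block word sum:** `w_{2n}(q) = Σ_{B₁, B₂ ⊆ [n]} q_{|B₁|+|B₂|} · μ_{B₁} · μ′_{B₂}`. -/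
theorem w_eq_sum_blocks (q : ℕ → K) :
    w K (n + n) (n + n) q = ∑ s : Finset (Fin n), ∑ t : Finset (Fin n), q (s.card + t.card) •
      ((List.ofFn fun k : Fin n => ι K (if k ∈ s then b K (In (n + n)) (yJ (n + n) (Fin.castAdd n k))
          else b K (In (n + n)) (xJ (n + n) (Fin.castAdd n k)))).prod *
       (List.ofFn fun k : Fin n => ι K (if k ∈ t then b K (In (n + n)) (yJ (n + n) (Fin.natAdd n k))
          else b K (In (n + n)) (xJ (n + n) (Fin.natAdd n k)))).prod) := by
  classical
  -- ungrade th-7's sum over `|T| = m`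
  have h1 : w K (n + n) (n + n) q = ∑ T : Finset (Fin (n + n)), q T.card • ExteriorAlgebra.ιMulti K (n + n) (vT K T) := by
    rw [f_eq_sum_ιMulti, ← Finset.powerset_univ, Finset.powerset_card_disjiUnion, Finset.sum_disjiUnion, Finset.card_univ,
      Fintype.card_fin]
    refine Finset.sum_congr rfl fun m _ => ?_
    rw [Finset.smul_sum]
    refine Finset.sum_congr rfl fun T hT => ?_
    rw [(Finset.mem_powersetCard.mp hT).2]
  -- reindex `T` by its two halves
  let E₀ : Finset (Fin n) × Finset (Fin n) ≃ Finset (Fin n ⊕ Fin n) :=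
    { toFun := fun p => p.1.disjSum p.2
      invFun := fun u => (u.toLeft, u.toRight)
      left_inv := fun p => by simp
      right_inv := fun u => Finset.toLeft_disjSum_toRight }
  let e : Finset (Fin n) × Finset (Fin n) ≃ Finset (Fin (n + n)) := E₀.trans (Equiv.finsetCongr finSumFinEquiv)
  have he : ∀ p : Finset (Fin n) × Finset (Fin n), e p = (p.1.disjSum p.2).map finSumFinEquiv.toEmbedding := fun p => rfl
  rw [h1, ← Fintype.sum_equiv e (fun p => q (e p).card • ExteriorAlgebra.ιMulti K (n + n) (vT K (e p))) _ (fun p => rfl),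
    Fintype.sum_prod_type]
  refine Finset.sum_congr rfl fun s _ => Finset.sum_congr rfl fun t _ => ?_
  rw [he, Finset.card_map, Finset.card_disjSum, ιMulti_vT_blocks]

/-! ### §2 The rows -/

/-- **ROW `Σ₁` IN THE MODEL:** `μ_B · w_{2n}(q) = (−1)^{C(n,2)+|B|} · Σ_{B′} q_{n−|B|+|B′|} · (m_P · μ′_{B′})`. -/
theorem wordP_mul_w (B : Finset (Fin n)) (q : ℕ → K) :
    (List.ofFn fun k : Fin n => ι K (if k ∈ B then b K (In (n + n)) (yJ (n + n) (Fin.castAdd n k))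
        else b K (In (n + n)) (xJ (n + n) (Fin.castAdd n k)))).prod * w K (n + n) (n + n) q =
      ((-1 : K) ^ (n.choose 2 + B.card)) • ∑ t : Finset (Fin n), q (n - B.card + t.card) •
        ((List.ofFn fun k : Fin n => ι K (b K (In (n + n)) (xJ (n + n) (Fin.castAdd n k))) *
            ι K (b K (In (n + n)) (yJ (n + n) (Fin.castAdd n k)))).prod *
         (List.ofFn fun k : Fin n => ι K (if k ∈ t then b K (In (n + n)) (yJ (n + n) (Fin.natAdd n k))
            else b K (In (n + n)) (xJ (n + n) (Fin.natAdd n k)))).prod) := by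
  classical
  have hBc : Bᶜ.card = n - B.card := by rw [Finset.card_compl, Fintype.card_fin]
  rw [w_eq_sum_blocks, Finset.mul_sum, Finset.sum_eq_single Bᶜ]
  · rw [Finset.mul_sum, Finset.smul_sum, hBc]
    refine Finset.sum_congr rfl fun t _ => ?_
    rw [mul_smul_comm, ← mul_assoc, word_mul_word_compl, smul_mul_assoc, smul_comm]
  · intro s _ hs
    rw [Finset.mul_sum]
    refine Finset.sum_eq_zero fun t _ => ?_
    rw [mul_smul_comm, ← mul_assoc, word_mul_word_eq_zero _ _ hs, zero_mul, smul_zero]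
  · intro h; exact (h (Finset.mem_univ _)).elim

/-- **ROW `Σ₂` IN THE MODEL:** `μ′_{B′} · w_{2n}(q) = (−1)^{n + C(n,2) + |B′|} · Σ_{B} q_{n−|B′|+|B|} · (μ_B · m_Q)`
(the extra `(−1)ⁿ = (−1)^{n·n}` from moving `μ′_{B′}` past `μ_B`). -/
theorem wordQ_mul_w (B' : Finset (Fin n)) (q : ℕ → K) :
    (List.ofFn fun k : Fin n => ι K (if k ∈ B' then b K (In (n + n)) (yJ (n + n) (Fin.natAdd n k))
        else b K (In (n + n)) (xJ (n + n) (Fin.natAdd n k)))).prod * w K (n + n) (n + n) q =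
      ((-1 : K) ^ (n + (n.choose 2 + B'.card))) • ∑ s : Finset (Fin n), q (n - B'.card + s.card) •
        ((List.ofFn fun k : Fin n => ι K (if k ∈ s then b K (In (n + n)) (yJ (n + n) (Fin.castAdd n k))
            else b K (In (n + n)) (xJ (n + n) (Fin.castAdd n k)))).prod *
         (List.ofFn fun k : Fin n => ι K (b K (In (n + n)) (xJ (n + n) (Fin.natAdd n k))) *
            ι K (b K (In (n + n)) (yJ (n + n) (Fin.natAdd n k)))).prod) := by
  classical
  have hBc : B'ᶜ.card = n - B'.card := by rw [Finset.card_compl, Fintype.card_fin]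
  rw [w_eq_sum_blocks, Finset.mul_sum]
  -- in each `s`-summand only `t = B'ᶜ` survives
  have inner : ∀ s : Finset (Fin n),
      (List.ofFn fun k : Fin n => ι K (if k ∈ B' then b K (In (n + n)) (yJ (n + n) (Fin.natAdd n k))
          else b K (In (n + n)) (xJ (n + n) (Fin.natAdd n k)))).prod *
        ∑ t : Finset (Fin n), q (s.card + t.card) •
          ((List.ofFn fun k : Fin n => ι K (if k ∈ s then b K (In (n + n)) (yJ (n + n) (Fin.castAdd n k))
              else b K (In (n + n)) (xJ (n + n) (Fin.castAdd n k)))).prod *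
           (List.ofFn fun k : Fin n => ι K (if k ∈ t then b K (In (n + n)) (yJ (n + n) (Fin.natAdd n k))
              else b K (In (n + n)) (xJ (n + n) (Fin.natAdd n k)))).prod) =
      ((-1 : K) ^ (n + (n.choose 2 + B'.card))) • (q (n - B'.card + s.card) •
        ((List.ofFn fun k : Fin n => ι K (if k ∈ s then b K (In (n + n)) (yJ (n + n) (Fin.castAdd n k))
            else b K (In (n + n)) (xJ (n + n) (Fin.castAdd n k)))).prod *
         (List.ofFn fun k : Fin n => ι K (b K (In (n + n)) (xJ (n + n) (Fin.natAdd n k))) *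
            ι K (b K (In (n + n)) (yJ (n + n) (Fin.natAdd n k)))).prod)) := by
    intro s
    rw [Finset.mul_sum, Finset.sum_eq_single B'ᶜ]
    · rw [mul_smul_comm, ← mul_assoc, prod_ofFn_mul_comm_self, smul_mul_assoc, mul_assoc, word_mul_word_compl,
        mul_smul_comm, smul_smul, smul_smul, smul_smul, hBc, Nat.add_comm s.card (n - B'.card), pow_add, pow_add]
      congr 1
      ring
    · intro t _ ht
      rw [mul_smul_comm, ← mul_assoc, prod_ofFn_mul_comm_self, smul_mul_assoc, mul_assoc, word_mul_word_eq_zero _ _ ht,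
        mul_zero, smul_zero, smul_zero]
    · intro h; exact (h (Finset.mem_univ _)).elim
  rw [Finset.sum_congr rfl (fun s _ => inner s), ← Finset.smul_sum]

end Summit.Ventures.HSemireg.Mod4Site
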